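import Summits.ResolutionOfSingularities.ResolutionOfSingularities.Theorems.FrobeniusLadderFInjectiveMacaulayficationFanCheckKit
import Mathlib.Algebra.BigOperators.Fin
import HarnessLib

/-!
# Soundness of the fan-check kit, I: semantics of the list primitives (crux `FInjectiveMacaulayfication`, road B, U12)

[OURS · L1 W4.5a] Support file for crux stmt-ResolutionOfSingularities-15315 (res-L1-w45a-plan-1 R12.33 (c), seat res-L1-w45a-stub-4).
Companion of `FanCheckKit` (the kernel-decidable bulk checkers of the fan-side binders of `PointFixableOfCert.pointFixable_of_ciCert`):
this file proves what the list programs of the kit COMPUTE, so that `FanCheckSoundBinders` can turn `checkX … = true` into the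
binders. Everything is elementary list bookkeeping:

* §A `getL` (structural `getD`): `getL_eq_getElem`, `getL_mem`, `getL_map_of_lt`, `getL_map_of_apply_default`, `getL_range`,
  membership of `(i, getL l i d)` in `(List.range n).zip l` and of `(getL l₁ i _, getL l₂ i _)` in `l₁.zip l₂`;
* §B the primitives: `forceL l k = k l`, `forceLL L k = k L` (the forcing combinators are semantically the identity),
  `veqL ⇒ =`, `vleL ⇒ ≤ entrywise`, `dotL`/`dotZL` = the `Fin n`-indexed sums (`dotL_eq_sum`, `dotZL_eq_sum`), entries and lengths
  of `smulL`, `addL`, `addUnitL`, `mulVecL`, `raysOf`, `colL`, `sumScaledL`, and the order facts `minDotL_le`, `minDotL2_le`,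
  `le_maxDotRows`, `checkHgeFrom_spec`.

No definitions, no named facts. AI-written, weaker than expert review; no statement of [claim: Hironaka2017] is used. [folklore]
-/

-- single-problem summit: the doubled namespace component is forced
set_option linter.dupNamespace false

namespace Summit.ResolutionOfSingularities.ResolutionOfSingularities.Theorems.FInjectiveMacaulayfication.FanCheckSound

open Summit.ResolutionOfSingularities.ResolutionOfSingularities.Theorems.FInjectiveMacaulayfication
open FanCheckKit

/-! ## §A List bookkeeping for the kit's primitives -/

section ListLemmas

variable {α : Type}

/-- `getL` on the empty list. [folklore] -/
theorem getL_nil (i : ℕ) (d : α) : getL ([] : List α) i d = d := by cases i <;> rfl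

/-- `getL` at the head. [folklore] -/
theorem getL_cons_zero (a : α) (as : List α) (d : α) : getL (a :: as) 0 d = a := rfl

/-- `getL` past the head. [folklore] -/
theorem getL_cons_succ (a : α) (as : List α) (i : ℕ) (d : α) : getL (a :: as) (i + 1) d = getL as i d := rfl

/-- `getL` is `List.getElem` in range. [folklore] -/
theorem getL_eq_getElem : ∀ (l : List α) (i : ℕ) (d : α) (h : i < l.length), getL l i d = l[i]
  | [], i, _, h => absurd h (by simp)
  | a :: as, 0, d, _ => rfl
  | a :: as, i + 1, d, h => by
    rw [getL_cons_succ, getL_eq_getElem as i d (by simpa using h)]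
    rfl

/-- `getL` past the end is the default. [folklore] -/
theorem getL_eq_default : ∀ (l : List α) (i : ℕ) (d : α), l.length ≤ i → getL l i d = d
  | [], i, d, _ => getL_nil i d
  | a :: as, 0, d, h => absurd h (by simp)
  | a :: as, i + 1, d, h => by
    rw [getL_cons_succ]
    exact getL_eq_default as i d (by simpa using h)

/-- In range, `getL` is a member. [folklore] -/
theorem getL_mem (l : List α) (i : ℕ) (d : α) (h : i < l.length) : getL l i d ∈ l := by
  rw [getL_eq_getElem l i d h]
  exact List.getElem_mem h

/-- `getL` of a `map`, in range. [folklore] -/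
theorem getL_map_of_lt {β : Type} (f : α → β) : ∀ (l : List α) (i : ℕ) (d : α) (d' : β), i < l.length →
    getL (l.map f) i d' = f (getL l i d)
  | [], i, _, _, h => absurd h (by simp)
  | a :: as, 0, d, d', _ => rfl
  | a :: as, i + 1, d, d', h => by
    rw [List.map_cons, getL_cons_succ, getL_cons_succ]
    exact getL_map_of_lt f as i d d' (by simpa using h)

/-- `getL` of a `map` whose function fixes the default, everywhere. [folklore] -/
theorem getL_map_of_apply_default {β : Type} (f : α → β) (d : α) (d' : β) (hf : f d = d') :
    ∀ (l : List α) (i : ℕ), getL (l.map f) i d' = f (getL l i d)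
  | [], i => by rw [List.map_nil, getL_nil, getL_nil, hf]
  | a :: as, 0 => rfl
  | a :: as, i + 1 => by
    rw [List.map_cons, getL_cons_succ, getL_cons_succ]
    exact getL_map_of_apply_default f d d' hf as i

/-- `getL (List.range n) i 0 = i` in range. [folklore] -/
theorem getL_range (n i : ℕ) (h : i < n) : getL (List.range n) i 0 = i := by
  rw [getL_eq_getElem _ _ _ (by simpa using h), List.getElem_range]

/-- Members of `(List.range n).zip l` are the pairs `(i, getL l i d)`. [folklore] -/
theorem mk_getL_mem_range_zip (n : ℕ) (l : List α) (d : α) (i : ℕ) (hi : i < n) (hl : i < l.length) :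
    (i, getL l i d) ∈ (List.range n).zip l := by
  have hlen : i < ((List.range n).zip l).length := by
    rw [List.length_zip, List.length_range]
    exact lt_min hi hl
  have h := List.getElem_mem hlen
  rwa [List.getElem_zip, List.getElem_range, ← getL_eq_getElem l i d hl] at h

/-- Members of `l₁.zip l₂` at a common index. [folklore] -/
theorem mk_getL_mem_zip {β : Type} (l₁ : List α) (l₂ : List β) (d₁ : α) (d₂ : β) (i : ℕ) (h₁ : i < l₁.length)
    (h₂ : i < l₂.length) : (getL l₁ i d₁, getL l₂ i d₂) ∈ l₁.zip l₂ := by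
  have hlen : i < (l₁.zip l₂).length := by
    rw [List.length_zip]
    exact lt_min h₁ h₂
  have h := List.getElem_mem hlen
  rwa [List.getElem_zip, ← getL_eq_getElem l₁ i d₁ h₁, ← getL_eq_getElem l₂ i d₂ h₂] at h

/-- A member of a list sits at some index, read by `getL`. [folklore] -/
theorem exists_getL_eq_of_mem (l : List α) (d : α) {x : α} (hx : x ∈ l) : ∃ i, i < l.length ∧ getL l i d = x := by
  obtain ⟨i, hi, rfl⟩ := List.mem_iff_getElem.mp hx
  exact ⟨i, hi, getL_eq_getElem l i d hi⟩

end ListLemmas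

/-! ## §B Semantics of the vector primitives -/

section Vectors

/-- `forceL l k = k l`. [folklore] -/
theorem forceL_eq : ∀ (l : List ℕ) (k : List ℕ → Bool), forceL l k = k l
  | [], k => rfl
  | a :: as, k => by rw [forceL, forceL_eq as]

/-- `forceLL L k = k L`. [folklore] -/
theorem forceLL_eq : ∀ (L : List (List ℕ)) (k : List (List ℕ) → Bool), forceLL L k = k L
  | [], k => rfl
  | v :: vs, k => by rw [forceLL, forceL_eq, forceLL_eq vs]

/-- `veqL` is equality. [folklore] -/
theorem eq_of_veqL : ∀ (l₁ l₂ : List ℕ), veqL l₁ l₂ = true → l₁ = l₂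
  | [], [], _ => rfl
  | [], _ :: _, h => by simp [veqL] at h
  | _ :: _, [], h => by simp [veqL] at h
  | a :: as, b :: bs, h => by
    simp only [veqL, Bool.and_eq_true, Nat.beq_eq] at h
    obtain ⟨h1, h2⟩ := h
    subst h1
    exact congrArg (List.cons a) (eq_of_veqL as bs h2)

/-- `vleL` is componentwise `≤` of lists of equal length. [folklore] -/
theorem le_of_vleL : ∀ (l₁ l₂ : List ℕ), vleL l₁ l₂ = true → l₁.length = l₂.length ∧ ∀ i : ℕ, getL l₁ i 0 ≤ getL l₂ i 0
  | [], [], _ => ⟨rfl, fun i => by rw [getL_nil]⟩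
  | [], _ :: _, h => by simp [vleL] at h
  | _ :: _, [], h => by simp [vleL] at h
  | a :: as, b :: bs, h => by
    simp only [vleL, Bool.and_eq_true, Nat.ble_eq] at h
    obtain ⟨hlen, hle⟩ := le_of_vleL as bs h.2
    refine ⟨by simp [hlen], fun i => ?_⟩
    cases i with
    | zero => exact h.1
    | succ i => rw [getL_cons_succ, getL_cons_succ]; exact hle i

/-- `dotL` is the `Fin n`-indexed sum of products, for two lists of length `n`. [folklore] -/
theorem dotL_eq_sum : ∀ (n : ℕ) (l₁ l₂ : List ℕ), l₁.length = n → l₂.length = n →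
    dotL l₁ l₂ = ∑ i : Fin n, vecOf n l₁ i * vecOf n l₂ i
  | 0, [], [], _, _ => by simp [dotL]
  | 0, _ :: _, _, h, _ => by simp at h
  | 0, [], _ :: _, _, h => by simp at h
  | n + 1, [], _, h, _ => by simp at h
  | n + 1, _ :: _, [], _, h => by simp at h
  | n + 1, a :: as, b :: bs, h₁, h₂ => by
    rw [dotL, Fin.sum_univ_succ, dotL_eq_sum n as bs (by simpa using h₁) (by simpa using h₂)]
    rfl

/-- `dotZL` likewise, with the first vector cast to `ℤ`. [folklore] -/
theorem dotZL_eq_sum : ∀ (n : ℕ) (l₁ : List ℕ) (l₂ : List ℤ), l₁.length = n → l₂.length = n →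
    dotZL l₁ l₂ = ∑ i : Fin n, ((vecOf n l₁ i : ℕ) : ℤ) * vecOfZ n l₂ i
  | 0, [], [], _, _ => by simp [dotZL]
  | 0, _ :: _, _, h, _ => by simp at h
  | 0, [], _ :: _, _, h => by simp at h
  | n + 1, [], _, h, _ => by simp at h
  | n + 1, _ :: _, [], _, h => by simp at h
  | n + 1, a :: as, b :: bs, h₁, h₂ => by
    rw [dotZL, Fin.sum_univ_succ, dotZL_eq_sum n as bs (by simpa using h₁) (by simpa using h₂)]
    rfl

/-- Entries of `smulL`. [folklore] -/
theorem getL_smulL (K : ℕ) (l : List ℕ) (i : ℕ) : getL (smulL K l) i 0 = K * getL l i 0 :=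
  getL_map_of_apply_default (fun x => K * x) 0 0 (Nat.mul_zero K) l i

/-- Length of `addL`: the shorter length. [folklore] -/
theorem length_addL_eq_min : ∀ (l₁ l₂ : List ℕ), (addL l₁ l₂).length = min l₁.length l₂.length
  | [], [] => rfl
  | [], _ :: _ => rfl
  | _ :: _, [] => rfl
  | a :: as, b :: bs => by
    rw [addL, List.length_cons, List.length_cons, List.length_cons, length_addL_eq_min as bs, Nat.succ_min_succ]

/-- Entries of `addL` on lists of equal length. [folklore] -/
theorem getL_addL : ∀ (l₁ l₂ : List ℕ), l₁.length = l₂.length → ∀ i : ℕ, getL (addL l₁ l₂) i 0 = getL l₁ i 0 + getL l₂ i 0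
  | [], [], _, i => by rw [show addL [] [] = [] from rfl, getL_nil]
  | [], _ :: _, h, _ => by simp at h
  | _ :: _, [], h, _ => by simp at h
  | a :: as, b :: bs, h, 0 => rfl
  | a :: as, b :: bs, h, i + 1 => by
    rw [addL, getL_cons_succ, getL_cons_succ, getL_cons_succ]
    exact getL_addL as bs (by simpa using h) i

/-- Length of `addUnitL`. [folklore] -/
theorem length_addUnitL : ∀ (w : List ℕ) (i : ℕ), (addUnitL w i).length = w.length
  | [], i => by cases i <;> rfl
  | a :: as, 0 => rfl
  | a :: as, i + 1 => by rw [addUnitL, List.length_cons, List.length_cons, length_addUnitL as i]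

/-- Entries of `addUnitL w i` in range: `w_j + [j = i]`. [folklore] -/
theorem getL_addUnitL : ∀ (w : List ℕ) (i j : ℕ), j < w.length →
    getL (addUnitL w i) j 0 = getL w j 0 + if j = i then 1 else 0
  | [], i, j, h => absurd h (by simp)
  | a :: as, 0, 0, _ => by simp [addUnitL, getL_cons_zero]
  | a :: as, 0, j + 1, _ => by simp [addUnitL, getL_cons_succ]
  | a :: as, i + 1, 0, _ => by simp [addUnitL, getL_cons_zero]
  | a :: as, i + 1, j + 1, h => by
    rw [addUnitL, getL_cons_succ, getL_cons_succ, getL_addUnitL as i j (by simpa using h)]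
    simp only [Nat.add_right_cancel_iff]

/-- Length of `mulVecL`. [folklore] -/
theorem length_mulVecL (rows : List (List ℕ)) (v : List ℕ) : (mulVecL rows v).length = rows.length := List.length_map _

/-- Entries of `mulVecL` in range. [folklore] -/
theorem getL_mulVecL (rows : List (List ℕ)) (v : List ℕ) (j : ℕ) (h : j < rows.length) :
    getL (mulVecL rows v) j 0 = dotL (getL rows j []) v :=
  getL_map_of_lt (fun row => dotL row v) rows j [] 0 h

/-- Length of `raysOf`. [folklore] -/
theorem length_raysOf (RAYS : List (List ℕ)) (idx : List ℕ) : (raysOf RAYS idx).length = idx.length := List.length_map _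

/-- Rows of `raysOf` in range. [folklore] -/
theorem getL_raysOf (RAYS : List (List ℕ)) (idx : List ℕ) (i : ℕ) (h : i < idx.length) :
    getL (raysOf RAYS idx) i [] = getL RAYS (getL idx i 0) [] :=
  getL_map_of_lt (fun j => getL RAYS j []) idx i 0 [] h

/-- Entries of `colL`. [folklore] -/
theorem getL_colL (vs : List (List ℕ)) (j' j : ℕ) : getL (colL vs j') j 0 = getL (getL vs j []) j' 0 :=
  getL_map_of_apply_default (fun v => getL v j' 0) [] 0 (getL_nil j' 0) vs j

/-- Length of `colL`. [folklore] -/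
theorem length_colL (vs : List (List ℕ)) (j' : ℕ) : (colL vs j').length = vs.length := List.length_map _

/-- Length of `sumScaledL`. [folklore] -/
theorem length_sumScaledL (n : ℕ) (d : List ℕ) (vs : List (List ℕ)) : (sumScaledL n d vs).length = n := by
  rw [sumScaledL, List.length_map, List.length_range]

/-- Entries of `sumScaledL` in range. [folklore] -/
theorem getL_sumScaledL (n : ℕ) (d : List ℕ) (vs : List (List ℕ)) (j' : ℕ) (h : j' < n) :
    getL (sumScaledL n d vs) j' 0 = dotL d (colL vs j') := by
  rw [sumScaledL, getL_map_of_lt (fun j' => dotL d (colL vs j')) (List.range n) j' 0 0 (by simpa using h), getL_range n j' h]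

/-- Unfolding `minDotL` on two or more elements. [folklore] -/
theorem minDotL_cons_cons (v e e' : List ℕ) (es : List (List ℕ)) :
    minDotL v (e :: e' :: es) = min (dotL v e) (minDotL v (e' :: es)) := rfl

/-- Unfolding `minDotL2` on two or more chunks. [folklore] -/
theorem minDotL2_cons_cons (v : List ℕ) (ch ch' : List (List ℕ)) (chs : List (List (List ℕ))) :
    minDotL2 v (ch :: ch' :: chs) = min (minDotL v ch) (minDotL2 v (ch' :: chs)) := rfl

/-- `minDotL v L ≤ ⟨v, e⟩` for every `e ∈ L`. [folklore] -/
theorem minDotL_le (v : List ℕ) : ∀ (L : List (List ℕ)) (e : List ℕ), e ∈ L → minDotL v L ≤ dotL v e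
  | [], e, h => absurd h (by simp)
  | [e'], e, h => by
    rw [List.mem_singleton] at h
    subst h
    exact le_rfl
  | e' :: e'' :: es, e, h => by
    rw [minDotL_cons_cons]
    rcases List.mem_cons.mp h with rfl | h
    · exact min_le_left _ _
    · exact le_trans (min_le_right _ _) (minDotL_le v (e'' :: es) e h)

/-- `minDotL2 v AL2 ≤ ⟨v, e⟩` for every `e` in the flattened two-level list. [folklore] -/
theorem minDotL2_le (v : List ℕ) : ∀ (AL2 : List (List (List ℕ))) (e : List ℕ), e ∈ AL2.flatten → minDotL2 v AL2 ≤ dotL v e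
  | [], e, h => absurd h (by simp)
  | [ch], e, h => by
    rw [List.flatten_cons, List.flatten_nil, List.append_nil] at h
    exact minDotL_le v ch e h
  | ch :: ch' :: chs, e, h => by
    rw [minDotL2_cons_cons]
    rw [List.flatten_cons, List.mem_append] at h
    rcases h with h | h
    · exact le_trans (min_le_left _ _) (minDotL_le v ch e h)
    · exact le_trans (min_le_right _ _) (minDotL2_le v (ch' :: chs) e h)

/-- `⟨v, m_c⟩ ≤ maxDotRows` for every chart record in the list one of whose rows carries the ray index `j`. [folklore] -/
theorem le_maxDotRows (AL2 : List (List (List ℕ))) (v : List ℕ) (j : ℕ) :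
    ∀ (CL : List (List ℕ × (ℕ × ℕ) × List (ℕ × ℕ) × List (List ℕ))) (ch : List ℕ × (ℕ × ℕ) × List (ℕ × ℕ) × List (List ℕ)),
      ch ∈ CL → (ch.1.any fun j' => Nat.beq j' j) = true → dotL v (get2 AL2 ch.2.1) ≤ maxDotRows AL2 CL v j
  | [], ch, h, _ => absurd h (by simp)
  | ch' :: CL, ch, h, hj => by
    rw [maxDotRows, List.foldr_cons]
    rcases List.mem_cons.mp h with rfl | h
    · rw [hj, cond_true]
      exact le_max_left _ _
    · have ih := le_maxDotRows AL2 v j CL ch h hj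
      rw [maxDotRows] at ih
      cases (ch'.1.any fun j' => Nat.beq j' j)
      · rw [cond_false]; exact ih
      · rw [cond_true]; exact le_trans ih (le_max_right _ _)

/-- `checkHgeFrom` unrolled: the inequality for every listed ray, with its running index. [folklore] -/
theorem checkHgeFrom_spec (AL2 : List (List (List ℕ))) (CL : List (List ℕ × (ℕ × ℕ) × List (ℕ × ℕ) × List (List ℕ))) :
    ∀ (j₀ : ℕ) (VS : List (List ℕ)), checkHgeFrom AL2 CL j₀ VS = true →
      ∀ k : ℕ, k < VS.length → maxDotRows AL2 CL (getL VS k []) (j₀ + k) ≤ minDotL2 (getL VS k []) AL2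
  | j₀, [], _, k, hk => absurd hk (by simp)
  | j₀, v :: vs, h, 0, _ => by
    simp only [checkHgeFrom, Bool.and_eq_true, Nat.ble_eq] at h
    rw [getL_cons_zero, Nat.add_zero]
    exact h.1
  | j₀, v :: vs, h, k + 1, hk => by
    simp only [checkHgeFrom, Bool.and_eq_true] at h
    rw [getL_cons_succ, ← Nat.add_assoc j₀, show j₀ + k + 1 = (j₀ + 1) + k by ring]
    exact checkHgeFrom_spec AL2 CL (j₀ + 1) vs h.2 k (by simpa using hk)

end Vectors

end Summit.ResolutionOfSingularities.ResolutionOfSingularities.Theorems.FInjectiveMacaulayfication.FanCheckSound
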